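import Summits.SmoothPoincare4.SmoothPoincare4.Theses.SullivanDual
import Summits.SmoothPoincare4.SmoothPoincare4.Theorems.SullivanDualRelativeSullivanDualityCone
import Summits.SmoothPoincare4.SmoothPoincare4.Theorems.SullivanDualRelativeSullivanDualityTame
import Literature.Geometry.Symplectic.TamingWitness
import Literature.Geometry.Symplectic.GromovR4RelEnd
import Literature.Geometry.Symplectic.GromovR4RelEndProofs
import Literature.Geometry.Manifold.OpenSubmanifoldMFDeriv

/-!
# SmoothPoincare4 / SullivanDual — `RelativeSullivanDuality` (support)

Settles item stmt-SmoothPoincare4-7827 of route SullivanDual: the relative Sullivan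
(Hahn–Banach) duality. For a homotopy `4`-sphere `Σ`, `p ∈ Σ`, a smooth almost complex structure
`J` on `Σ ∖ p`, a radius `ε > 0` such that SOME smooth closed `2`-form is standard (equal to the
inverted-chart model `ι*ω₀`) on the punctured `ε`-chart-ball `B_ε`: if there is no taming witness
at radius `ε` (no linear functional `T` on `2`-forms with (W1) `T > 0` on smooth forms taming `J`
off `B_ε`, (W2) `T = 0` on smooth closed forms vanishing on `B_ε`, (W3) `T ≤ 0` on smooth closed
forms standard on `B_ε`), then some `sf` is symplectic, standard near `p` at radius `ε`
(`IsSymplecticStandardNearPoint p ε sf`) and tames `J` off `B_ε`.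

Proof (Sullivan 1976, Thm. I.7; Harvey–Lawson 1983; the route's rationale). Work in the real
vector space `E'` of smooth `2`-forms on `Σ ∖ p`. The forms taming `J` off `B_ε` form a convex
cone `Q ⊆ E'`, algebraically open because `K_ε = (Σ ∖ p) ∖ B_ε` is compact
(`exists_uniform_tames_add_smul`, file `…Tame`). The smooth closed forms vanishing on `B_ε` form
a subspace `V`, and the smooth closed forms standard on `B_ε` are the coset `α₀ + V`.
* If `Q` meets `α₀ + V` in `sf`, then `sf` is smooth, closed, standard on `B_ε`, tames `J` off
  `B_ε` (nondegenerate there: `sf(v, Jv) > 0`), and is nondegenerate ON `B_ε` because the model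
  `ι*ω₀` is pulled back through the invertible `De_x` and `Dι` (`exists_invertedStdForm_ne_zero`).
* Otherwise the algebraic cone duality (`exists_pos_functional_of_convex_cone_disjoint`, file
  `…Cone`) gives `T₀ : E' →ₗ ℝ`, positive on `Q`, zero on `V`, `T₀ α₀ ≤ 0`; any linear extension
  `T` to all `2`-forms (`LinearMap.exists_extend`) is a taming witness — contradiction.
No named facts are used; the theorem is unconditional.
-/

-- the prescribed namespace `Summit.<P>.<Sub>.…` duplicates `SmoothPoincare4` (P = Sub)
set_option linter.dupNamespace false

noncomputable section

namespace Summit.SmoothPoincare4.SmoothPoincare4.Theorems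

open scoped Manifold ContDiff Topology
open Set Filter Literature.Geometry.Kaehler Literature.Geometry.Symplectic

/-! ### Nondegeneracy of the model end `ι*ω₀` read through the chart -/

/-- The derivative of the inversion `ι(z) = z/‖z‖²` at `y ≠ 0` is bijective: `ι ∘ ι = id`, so
`Dι(ι y) ∘ Dι(y) = id = Dι(y) ∘ Dι(ι y)` by the chain rule. [folklore] -/
theorem fderiv_inversion_bijective {y : EuclideanSpace ℝ (Fin 4)} (hy : y ≠ 0) :
    Function.Bijective (fderiv ℝ inversion y) := by
  have hcomp : ∀ z : EuclideanSpace ℝ (Fin 4), z ≠ 0 →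
      (fderiv ℝ inversion (inversion z)).comp (fderiv ℝ inversion z) =
        ContinuousLinearMap.id ℝ (EuclideanSpace ℝ (Fin 4)) := by
    intro z hz
    have h1 : HasFDerivAt inversion (fderiv ℝ inversion z) z :=
      (differentiableAt_inversion hz).hasFDerivAt
    have h2 : HasFDerivAt inversion (fderiv ℝ inversion (inversion z)) (inversion z) :=
      (differentiableAt_inversion (inversion_ne_zero hz)).hasFDerivAt
    have h3 := h2.comp z h1
    have hid : (inversion ∘ inversion : EuclideanSpace ℝ (Fin 4) → EuclideanSpace ℝ (Fin 4)) =
        id := funext fun w => inversion_inversion w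
    rw [hid] at h3
    exact h3.unique (hasFDerivAt_id z)
  have hleft : Function.LeftInverse (fderiv ℝ inversion (inversion y)) (fderiv ℝ inversion y) :=
    fun v => by
      have h := DFunLike.congr_fun (hcomp y hy) v
      simpa using h
  have hright : Function.RightInverse (fderiv ℝ inversion (inversion y))
      (fderiv ℝ inversion y) := fun v => by
    have h := DFunLike.congr_fun (hcomp (inversion y) (inversion_ne_zero hy)) v
    rw [inversion_inversion] at h
    simpa using h
  exact ⟨hleft.injective, hright.surjective⟩

variable {M : Type*} [TopologicalSpace M] [T2Space M] [ChartedSpace (EuclideanSpace ℝ (Fin 4)) M]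
  [IsManifold (𝓡 4) ∞ M]

/-- The differential `De_x` of the chart at `p`, read on the open submanifold `M ∖ {p}` at a
point `x` of the chart source, is bijective (chain rule through the inclusion, whose
differential is the identity, and `isInvertible_mfderiv_extChartAt`). [folklore] -/
theorem mfderiv_extChartAt_punctured_bijective (p : M) (x : punctured p)
    (hx : x.1 ∈ (chartAt (EuclideanSpace ℝ (Fin 4)) p).source) :
    Function.Bijective (mfderiv (𝓡 4) 𝓘(ℝ, EuclideanSpace ℝ (Fin 4))
      (fun z : punctured p => extChartAt (𝓡 4) p z.1) x) := by
  have hval := Literature.Geometry.Manifold.OpenSubmanifold.hasMFDerivAt_subtype_val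
    (I := 𝓡 4) (U := punctured p) x
  have he : HasMFDerivAt (𝓡 4) 𝓘(ℝ, EuclideanSpace ℝ (Fin 4)) (extChartAt (𝓡 4) p) x.1
      (mfderiv (𝓡 4) 𝓘(ℝ, EuclideanSpace ℝ (Fin 4)) (extChartAt (𝓡 4) p) x.1) :=
    (mdifferentiableAt_extChartAt hx).hasMFDerivAt
  have hcomp := he.comp x hval
  have heq : mfderiv (𝓡 4) 𝓘(ℝ, EuclideanSpace ℝ (Fin 4))
      (fun z : punctured p => extChartAt (𝓡 4) p z.1) x =
        (mfderiv (𝓡 4) 𝓘(ℝ, EuclideanSpace ℝ (Fin 4)) (extChartAt (𝓡 4) p) x.1).comp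
          (ContinuousLinearMap.id ℝ (EuclideanSpace ℝ (Fin 4))) := hcomp.mfderiv
  have hxe : x.1 ∈ (extChartAt (𝓡 4) p).source := by rwa [extChartAt_source]
  obtain ⟨L, hL⟩ := isInvertible_mfderiv_extChartAt (I := 𝓡 4) hxe
  have hD : Function.Bijective
      (mfderiv (𝓡 4) 𝓘(ℝ, EuclideanSpace ℝ (Fin 4)) (extChartAt (𝓡 4) p) x.1) := by
    rw [← hL]
    exact L.bijective
  rw [heq]
  exact hD.comp Function.bijective_id

/-- **The model end is nondegenerate**: for `x` in the punctured chart source at `p` and `v ≠ 0`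
in `T_x(M ∖ p)` there is `w` with `(ι*ω₀)_{e x − e p}(De_x v, De_x w) ≠ 0` — `ω₀` is
nondegenerate (`ω₀(u, J₀ u) = ‖u‖²`) and `De_x`, `Dι(e x − e p)` are bijective (`e x ≠ e p` by
injectivity of the chart). [folklore] -/
theorem exists_invertedStdForm_ne_zero (p : M) (x : punctured p)
    (hx : x.1 ∈ (chartAt (EuclideanSpace ℝ (Fin 4)) p).source)
    (v : TangentSpace (𝓡 4) x) (hv : v ≠ 0) :
    ∃ w : TangentSpace (𝓡 4) x,
      invertedStdForm (extChartAt (𝓡 4) p x.1 - extChartAt (𝓡 4) p p)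
        (mfderiv (𝓡 4) 𝓘(ℝ, EuclideanSpace ℝ (Fin 4))
          (fun z : punctured p => extChartAt (𝓡 4) p z.1) x v)
        (mfderiv (𝓡 4) 𝓘(ℝ, EuclideanSpace ℝ (Fin 4))
          (fun z : punctured p => extChartAt (𝓡 4) p z.1) x w) ≠ 0 := by
  set e := extChartAt (𝓡 4) p with he_def
  set De := mfderiv (𝓡 4) 𝓘(ℝ, EuclideanSpace ℝ (Fin 4)) (fun z : punctured p => e z.1) x
    with hDe_def
  have hne : e x.1 - e p ≠ 0 := by
    intro h0
    have h1 : e x.1 = e p := sub_eq_zero.1 h0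
    have hsrc : (chartAt (EuclideanSpace ℝ (Fin 4)) p).source = e.source :=
      (extChartAt_source (I := 𝓡 4) p).symm
    have h2 : x.1 = p :=
      e.injOn (show x.1 ∈ e.source from hsrc ▸ hx)
        (show p ∈ e.source from mem_extChartAt_source (I := 𝓡 4) p) h1
    exact (mem_punctured.1 x.2) h2
  have hDe : Function.Bijective De := mfderiv_extChartAt_punctured_bijective p x hx
  have hDι : Function.Bijective (fderiv ℝ inversion (e x.1 - e p)) :=
    fderiv_inversion_bijective hne
  have ha : fderiv ℝ inversion (e x.1 - e p) (De v) ≠ 0 := by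
    intro h0
    apply hv
    have h1 : De v = 0 := hDι.1 (h0.trans (map_zero _).symm)
    exact hDe.1 (h1.trans (map_zero De).symm)
  obtain ⟨b, hb⟩ := stdSymplecticMForm_nondegenerate 0 _ ha
  rw [stdSymplecticMForm_apply] at hb
  obtain ⟨w', hw'⟩ := hDι.2 b
  obtain ⟨w, hw⟩ := hDe.2 w'
  refine ⟨w, ?_⟩
  show stdSymplecticForm (fderiv ℝ inversion (e x.1 - e p) (De v))
    (fderiv ℝ inversion (e x.1 - e p) (De w)) ≠ 0
  rwa [hw, hw']

/-! ### The duality -/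

/-- Settles stmt-SmoothPoincare4-7827 (`RelativeSullivanDuality`, support of route SullivanDual):
for a homotopy `4`-sphere `Σ`, `p ∈ Σ`, a smooth almost complex structure `J` on `Σ ∖ p` and
`ε > 0` such that some smooth closed `2`-form is standard on the punctured `ε`-chart-ball, if NO
taming witness at radius `ε` exists then some `2`-form `sf` satisfies
`IsSymplecticStandardNearPoint p ε sf` and tames `J` off the ball. Sullivan's Hahn–Banach
alternative (Sullivan 1976, Thm. I.7) relative to the standard end: either the algebraically
open convex cone `Q` of smooth forms taming `J` off `B_ε` (open by compactness of `K_ε`,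
`exists_uniform_tames_add_smul`) meets the coset `α₀ + V` of smooth closed forms standard on
`B_ε` — giving `sf`, nondegenerate on `B_ε` by `exists_invertedStdForm_ne_zero` — or
`exists_pos_functional_of_convex_cone_disjoint` + `LinearMap.exists_extend` produce a taming
witness. Unconditional (no named facts). [folklore] -/
theorem RelativeSullivanDuality_proof :
    Summit.SmoothPoincare4.SmoothPoincare4.Theses.SullivanDual.RelativeSullivanDuality := by
  unfold Summit.SmoothPoincare4.SmoothPoincare4.Theses.SullivanDual.RelativeSullivanDuality
  intro S p J ε hε hJ2 hJs hex hNoW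
  obtain ⟨α₀, hα₀s, hα₀c, hα₀m⟩ := hex
  by_cases hgood : ∃ sf : MForm (𝓡 4) (punctured p) ℝ 2, IsSmoothForm sf ∧ IsClosedForm sf ∧
      IsStandardOnBall p ε sf ∧ TamesOffBall p ε J sf
  · -- a closed taming form standard on the ball is the required symplectic form
    obtain ⟨sf, hs, hc, hstd, ht⟩ := hgood
    refine ⟨sf, ⟨hε, hs, hc, ?_, fun x hxs hxb v w => hstd x ⟨hxs, hxb⟩ v w⟩, ht⟩
    intro x v hv
    by_cases hx : InPuncturedChartBall p ε x
    · obtain ⟨w, hw⟩ := exists_invertedStdForm_ne_zero p x hx.1 v hv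
      exact ⟨w, by rw [hstd x hx v w]; exact hw⟩
    · exact ⟨J x v, (ht x hx v hv).ne'⟩
  · -- otherwise Hahn–Banach produces a taming witness
    exfalso
    -- the compact piece `K_ε`
    have hK : IsCompact ({x : punctured p | InPuncturedChartBall p ε x}ᶜ) :=
      gromov_recognitionR4_relEnd.isCompact_compl_setOf_inPuncturedChartBall p hε
    -- the space of smooth forms, the cone `Q`, the subspace `V`, the point `a`
    set E' := ↥(smoothForms (𝓡 4) (punctured p) ℝ 2) with hE'
    set Q : Set E' := {q | TamesOffBall p ε J (q : MForm (𝓡 4) (punctured p) ℝ 2)} with hQ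
    let V : Submodule ℝ E' :=
      { carrier := {q | IsClosedForm (q : MForm (𝓡 4) (punctured p) ℝ 2) ∧
          ∀ x : punctured p, InPuncturedChartBall p ε x →
            (q : MForm (𝓡 4) (punctured p) ℝ 2) x = 0}
        add_mem' := by
          rintro q₁ q₂ ⟨h₁c, h₁v⟩ ⟨h₂c, h₂v⟩
          refine ⟨((closedSmoothForms (𝓡 4) (punctured p) ℝ 2).add_mem ⟨q₁.2, h₁c⟩
            ⟨q₂.2, h₂c⟩).2, fun x hx => ?_⟩
          show (q₁ : MForm (𝓡 4) (punctured p) ℝ 2) x + (q₂ : MForm (𝓡 4) (punctured p) ℝ 2) x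
            = 0
          rw [h₁v x hx, h₂v x hx, add_zero]
        zero_mem' := ⟨mextDeriv_zero, fun x _ => rfl⟩
        smul_mem' := by
          rintro c q ⟨hqc, hqv⟩
          refine ⟨((closedSmoothForms (𝓡 4) (punctured p) ℝ 2).smul_mem c ⟨q.2, hqc⟩).2,
            fun x hx => ?_⟩
          show c • (q : MForm (𝓡 4) (punctured p) ℝ 2) x = 0
          rw [hqv x hx, smul_zero] }
    set a : E' := ⟨α₀, hα₀s⟩ with ha
    -- hypotheses of the cone duality
    have hQc : Convex ℝ Q := by
      intro q₁ hq₁ q₂ hq₂ s t hs ht hst x hx v hv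
      have hA := hq₁ x hx v hv
      have hB := hq₂ x hx v hv
      show 0 < (s • (q₁ : MForm (𝓡 4) (punctured p) ℝ 2) +
        t • (q₂ : MForm (𝓡 4) (punctured p) ℝ 2)) x ![v, J x v]
      simp only [Pi.add_apply, Pi.smul_apply, ContinuousAlternatingMap.add_apply,
        ContinuousAlternatingMap.smul_apply, smul_eq_mul]
      rcases eq_or_lt_of_le hs with h0 | hs'
      · subst h0
        rw [zero_add] at hst
        subst hst
        linarith
      · nlinarith [mul_pos hs' hA, mul_nonneg ht hB.le]
    have hcone : ∀ (c : ℝ) (q : E'), 0 < c → q ∈ Q → c • q ∈ Q := by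
      intro c q hc hq x hx v hv
      show 0 < (c • (q : MForm (𝓡 4) (punctured p) ℝ 2)) x ![v, J x v]
      simp only [Pi.smul_apply, ContinuousAlternatingMap.smul_apply, smul_eq_mul]
      exact mul_pos hc (hq x hx v hv)
    have hopen : ∀ q ∈ Q, ∀ b : E', ∃ δ : ℝ, 0 < δ ∧ ∀ t : ℝ, |t| ≤ δ → q + t • b ∈ Q := by
      intro q hq b
      obtain ⟨δ, hδ, h⟩ := exists_uniform_tames_add_smul (N := punctured p) hK q.2 b.2 J hJs
        (fun x hx v hv => hq x hx v hv)
      exact ⟨δ, hδ, fun t ht x hx v hv => h t ht x hx v hv⟩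
    have hdisj : ∀ w ∈ V, a + w ∉ Q := by
      intro w hw hmem
      apply hgood
      refine ⟨α₀ + (w : MForm (𝓡 4) (punctured p) ℝ 2), hα₀s.add w.2,
        ((closedSmoothForms (𝓡 4) (punctured p) ℝ 2).add_mem ⟨hα₀s, hα₀c⟩ ⟨w.2, hw.1⟩).2,
        fun x hx v u => ?_, hmem⟩
      show α₀ x ![v, u] + (w : MForm (𝓡 4) (punctured p) ℝ 2) x ![v, u] = _
      rw [hw.2 x hx, ContinuousAlternatingMap.coe_zero, Pi.zero_apply, add_zero]
      exact hα₀m x hx v u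
    obtain ⟨T₀, hT₀Q, hT₀V, hT₀a⟩ :=
      exists_pos_functional_of_convex_cone_disjoint hQc hcone hopen hdisj
    -- extend `T₀` to all `2`-forms
    obtain ⟨T, hT⟩ := LinearMap.exists_extend T₀
    have hTq : ∀ q : E', T (q : MForm (𝓡 4) (punctured p) ℝ 2) = T₀ q := fun q =>
      LinearMap.congr_fun hT q
    -- `T` is a taming witness
    refine hNoW T ⟨?_, ?_, ?_⟩
    · intro α hαs htame
      rw [hTq ⟨α, hαs⟩]
      exact hT₀Q _ htame
    · intro α hαs hαc h0
      rw [hTq ⟨α, hαs⟩]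
      exact hT₀V _ ⟨hαc, h0⟩
    · intro α hαs hαc hstd
      have hvV : (⟨α, hαs⟩ - a : E') ∈ V := by
        refine ⟨((closedSmoothForms (𝓡 4) (punctured p) ℝ 2).sub_mem ⟨hαs, hαc⟩
          ⟨hα₀s, hα₀c⟩).2, fun x hx => ?_⟩
        show α x - α₀ x = 0
        ext m
        have hm : m = ![m 0, m 1] := by
          funext i
          fin_cases i <;> rfl
        rw [ContinuousAlternatingMap.sub_apply, ContinuousAlternatingMap.coe_zero, Pi.zero_apply,
          hm, hstd x hx (m 0) (m 1), hα₀m x hx (m 0) (m 1), sub_self]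
      have h1 : T α = T₀ a + T₀ (⟨α, hαs⟩ - a) := by
        rw [← map_add, add_sub_cancel, ← hTq ⟨α, hαs⟩]
      rw [h1, hT₀V _ hvV, add_zero]
      exact hT₀a

end Summit.SmoothPoincare4.SmoothPoincare4.Theorems
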